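import Literature.MathematicalPhysics.QuantumFieldTheory.OSGlaserKernelIdentity
import Literature.MathematicalPhysics.QuantumFieldTheory.OSWightmanVectors
import Literature.MathematicalPhysics.QuantumFieldTheory.OSTimeContinuationProofs
import Literature.MathematicalPhysics.QuantumFieldTheory.OSTimePaleyWienerTools
import Literature.Analysis.FunctionSpaces.WightmanGNSSpectral
import Literature.MathematicalPhysics.QuantumLattice.SchwartzTensorDensityProofs
import HarnessLib

/-!
# The spectral support of an OS continuation family, and `OS1973_cluster_holds`

Discharge of the named facts
`Literature.MathematicalPhysics.QuantumFieldTheory.OS1973_cluster` (Osterwalder–Schrader I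
(1973), §4.4: the cluster property R4 of the boundary values of an OS continuation family) and
`Literature.MathematicalPhysics.QuantumFieldTheory.OS1973_spectralCondition` (§4.1 p. 93: the
spectral condition R5) **without the analytic continuation theory of OS II**: for an OS family
`S` and *any* OS continuation family `𝒲` of `S` (`IsOSContinuationFamily`: `𝒲ₙ` is the
distributional boundary value of a function holomorphic on the forward tube reproducing `𝔖ₙ` at
Euclidean points), the Fourier transform of `𝒲ₙ` is supported in the half-space spectral set
`{∑ pⱼ = 0, (∑_{j ≤ k} pⱼ)⁰ ≥ 0}` (`IsOSContinuationFamily.fourierSupportedIn_halfSpectralSet`).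
With the tree's `hasSpectralCondition_of_halfSpace` (Lorentz invariance, proved from E1) this is
the spectral condition, i.e. `SpectralOSData S 𝒲` (`OSWightmanVectors`), whence the Wightman
vectors of OS I §4.3 and the cluster property through `OS1973_cluster_of_vectors`.

## The argument (positivity of the energy instead of temperedness estimates)

No growth estimate on the continuation is available from `IsOSContinuationFamily` (only ray
limits), so the Fourier–Laplace route of OS II is closed; instead the support is read off the
**positivity of the energy in the OS Hilbert space** through the Glaser vectors of
`OSGlaserVectors`–`OSGlaserKernelIdentity`:

1. **Paley–Wiener at level `s > 0`** (`GlaserHyp.integral_fourierInv_mul_inner_timeGroupOp_eq_zero`). For compactly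
   supported `F` (`n` points), `G` (`m` points) and the ray smearings `b_F = ∫ F Ψ(· + isη)`,
   `b_G`, the function `l ↦ 𝕂(ρ_F, ρ_G + l ê₀) · R_g(l)` (`R_g = laplaceExt g`, `g ∈ 𝓢(ℝ)` with
   compact support in `[0, ∞)`) is holomorphic on `{Im l > −s}` and on `{Im l ≥ 0}` equals
   `⟪b_F, e^{-(-il)H} b_G⟫ R_g(l)`, bounded by `‖b_F‖ ‖b_G‖ C (1 + |l|)⁻²` (contraction property of
   the holomorphic semigroup, `OSDistributionSpaceHolomorphicSemigroupLaw`); pushing the line of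
   integration to `+i∞` (`integral_eq_zero_of_norm_le_upperHalfPlane`),
   `∫ 𝓕⁻¹g(t) ⟪b_F, U(t) b_G⟫ dt = 0`, i.e. by the pairing formula
   `∫ 𝓕⁻¹g(t) [∫ 𝔚_{n+m}(X + isη^{nm}) (F^† ⊗ G_t)(X) dX] dt = 0`.
2. **`s → 0⁺`** (`integral_fourierInv_mul_apply_appendTensor_translate_eq_zero`): the inner
   integral tends to the boundary value `𝒲_{n+m}(F^† ⊗ G_t)` (ray limit along `η^{nm}`), and is
   bounded by `‖b_F‖ ‖b_G‖`, whose squares tend to `𝒲_{2n}(F^† ⊗ F)`, `𝒲_{2m}(G^† ⊗ G)`; dominated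
   convergence in `t` gives `∫ 𝓕⁻¹g(t) 𝒲_{n+m}(F^† ⊗ G_t) dt = 0`.
3. **The exchange** (`apply_unflatten_fourierInv_smulLeftCLM_eq_integral`, the one-parameter
   version of the computation of `WightmanGNSSpectral`): for every tempered `T`, test function `Ψ`,
   direction `v` and `g ∈ 𝓢(ℝ)`,
   `T(unflatten 𝓕⁻¹(g(⟨·, ṽ⟩) 𝓕Ψ̃)) = ∫ 𝓕⁻¹g(s) T(Ψ(· − s v)) ds`.
   With `v = (0, …, 0, ê₀, …, ê₀)` and step 2, `𝒲_N` vanishes on the Fourier multiplier images of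
   the compactly supported two-block tensors, which are total (`denseSpan_tensorProducts_holds`),
   hence the Fourier transform of `𝒲_N` vanishes on `{(∑_{j > k} pⱼ)⁰ > 0}`; with
   `v = (ê_μ, …, ê_μ)` and translation invariance, it vanishes on `{∑ pⱼ^μ ≠ 0}`. These open sets
   cover the complement of the half-space spectral set (`compl_image_halfSpectralSet_subset`,
   `OSTimeContinuationProofs`), and the sheaf property of `SchwartzDistributionSupport` concludes.

Only E1 and E2 of the OS axioms enter (E4 enters the cluster property through
`OS1973_cluster_of_vectors`); the linear growth condition E0' is not used.

## References

* K. Osterwalder, R. Schrader, *Axioms for Euclidean Green's functions*, Comm. Math. Phys. 31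
  (1973) 83–112, §4.1 p. 93 (R5), §4.3 (4.21)–(4.28), §4.4 (4.29)–(4.30). [OsterwalderSchraderCMP1973]
* V. Glaser, Comm. Math. Phys. 37 (1974) 257–272, §2. [GlaserCMP1974]
* R. F. Streater, A. S. Wightman, *PCT, Spin and Statistics, and All That* (1964), Thm. 2-8.
  [StreaterWightman1964]
-/

noncomputable section

open MeasureTheory Filter Complex ComplexConjugate Metric Set FourierTransform
open scoped Topology ComplexOrder SchwartzMap BigOperators InnerProductSpace RealInnerProductSpace ContDiff

namespace Literature.MathematicalPhysics.QuantumFieldTheory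

open Literature.MathematicalPhysics.QuantumLattice Literature.Analysis.Complex Literature.Analysis.FunctionSpaces
open Literature.MathematicalPhysics.QuantumLattice.SchwingerFamily (OSSpace OSHilbert PosGen genPairing)
open Literature.MathematicalPhysics.QuantumLattice.SchwingerFamily.OSSpace

variable {d : ℕ}

/-! ### The exchange formula for one-parameter translations -/

section Exchange

variable {N : ℕ}

/-- **Fourier inversion at the origin**: `∫ 𝓕⁻¹g = g(0)` for Schwartz `g`. [folklore] -/
theorem integral_fourierInv_eq_apply_zero (g : 𝓢(ℝ, ℂ)) : ∫ s : ℝ, (𝓕⁻ g : 𝓢(ℝ, ℂ)) s = g 0 := by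
  have h1 : (𝓕 (⇑(𝓕⁻ g : 𝓢(ℝ, ℂ)))) 0 = ∫ s : ℝ, (𝓕⁻ g : 𝓢(ℝ, ℂ)) s := by
    rw [Real.fourier_real_eq]
    refine integral_congr_ae (Eventually.of_forall fun s => ?_)
    simp
  rw [← h1, ← SchwartzMap.fourier_coe, FourierInvPair.fourier_fourierInv_eq]

/-- **The exchange formula for one-parameter translations** (one-parameter version of the
computation of `WightmanGNSSpectral`): for a tempered distribution `T`, a test function `Ψ`, a
translation vector `v` and `g ∈ 𝓢(ℝ)`,
`T(unflatten 𝓕⁻¹(g(⟨·, ṽ⟩) · 𝓕Ψ̃)) = ∫ 𝓕⁻¹g(s) · T(Ψ(· − s v)) ds`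
(`𝓕(Ψ(· − sv))˜ = e^{−2πis⟨ṽ, ·⟩} 𝓕Ψ̃`, `∫ 𝓕⁻¹g(s) e^{−2πisξ} ds = g(ξ)`, and the exchange theorem
`SchwartzMap.apply_eq_integral_of_forall_apply_eq_integral`). [folklore] -/
theorem apply_unflatten_fourierInv_smulLeftCLM_eq_integral (T : 𝓢((Fin N → SpaceTime d), ℂ) →L[ℂ] ℂ)
    (v : Fin N → SpaceTime d) (g : 𝓢(ℝ, ℂ)) (Ψ : 𝓢((Fin N → SpaceTime d), ℂ)) :
    T (SchwartzMap.compCLMOfContinuousLinearEquiv ℂ (flattenCLE d N)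
      (𝓕⁻ (SchwartzMap.smulLeftCLM ℂ (fun w => g ⟪w, flattenCLE d N v⟫)
        (𝓕 (flattenTest Ψ))))) =
      ∫ s : ℝ, (𝓕⁻ g : 𝓢(ℝ, ℂ)) s * T (SchwartzMap.compSubConstCLM ℂ (s • v) Ψ) := by
  -- notation
  set Gf : 𝓢(EuclideanSpace ℝ (Fin N × Fin (d + 1)), ℂ) := flattenTest Ψ with hGf
  set FT : 𝓢(EuclideanSpace ℝ (Fin N × Fin (d + 1)), ℂ) →L[ℂ]
      𝓢(EuclideanSpace ℝ (Fin N × Fin (d + 1)), ℂ) := SchwartzMap.fourierTransformCLM ℂ with hFTdef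
  set G₀ : 𝓢(EuclideanSpace ℝ (Fin N × Fin (d + 1)), ℂ) := FT Gf with hG₀
  set flatv : EuclideanSpace ℝ (Fin N × Fin (d + 1)) := flattenCLE d N v with hflatv
  set vmap : ℝ →L[ℝ] EuclideanSpace ℝ (Fin N × Fin (d + 1)) := ContinuousLinearMap.toSpanSingleton ℝ flatv
    with hvmap
  have hvmap_apply : ∀ s : ℝ, vmap s = flattenCLE d N (s • v) := fun s => by
    simp [hvmap, hflatv, ContinuousLinearMap.toSpanSingleton_apply, map_smul]
  set Ψf : ℝ → 𝓢(EuclideanSpace ℝ (Fin N × Fin (d + 1)), ℂ) := fun s =>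
    FT (SchwartzMap.compSubConstCLM ℂ (vmap s) Gf) with hΨf
  have hΨeq : ∀ s : ℝ, flattenTest (SchwartzMap.compSubConstCLM ℂ (s • v) Ψ) =
      SchwartzMap.compSubConstCLM ℂ (vmap s) Gf := fun s => by
    rw [WightmanFamily.flattenTest_compSubConstCLM, hvmap_apply]
  -- the unflattening and the inverse Fourier transform as CLMs
  set unflat : 𝓢(EuclideanSpace ℝ (Fin N × Fin (d + 1)), ℂ) →L[ℂ] 𝓢((Fin N → SpaceTime d), ℂ) :=
    SchwartzMap.compCLMOfContinuousLinearEquiv ℂ (flattenCLE d N) with hunflatdef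
  have hunflat : ∀ F : 𝓢((Fin N → SpaceTime d), ℂ), unflat (flattenTest F) = F := fun F => by
    ext x; simp [hunflatdef]
  set FTinv : 𝓢(EuclideanSpace ℝ (Fin N × Fin (d + 1)), ℂ) →L[ℂ]
      𝓢(EuclideanSpace ℝ (Fin N × Fin (d + 1)), ℂ) :=
    ((FourierTransform.fourierCLE ℂ (𝓢(EuclideanSpace ℝ (Fin N × Fin (d + 1)), ℂ))).symm :
      𝓢(EuclideanSpace ℝ (Fin N × Fin (d + 1)), ℂ) →L[ℂ]
        𝓢(EuclideanSpace ℝ (Fin N × Fin (d + 1)), ℂ)) with hFTinvdef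
  have hFTinv : ∀ H, FTinv H = 𝓕⁻ H := fun H => rfl
  have hFT : ∀ H, FT H = 𝓕 H := fun H => rfl
  set S : 𝓢(EuclideanSpace ℝ (Fin N × Fin (d + 1)), ℂ) →L[ℂ] ℂ := T.comp (unflat.comp FTinv) with hS
  have hSΨ : ∀ s, S (Ψf s) = T (SchwartzMap.compSubConstCLM ℂ (s • v) Ψ) := by
    intro s
    change T (unflat (FTinv (FT (SchwartzMap.compSubConstCLM ℂ (vmap s) Gf)))) = _
    rw [hFTinv, hFT, FourierPair.fourierInv_fourier_eq, ← hΨeq, hunflat]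
  -- the test function on the Fourier side
  have hm : Function.HasTemperateGrowth fun P : EuclideanSpace ℝ (Fin N × Fin (d + 1)) => g ⟪P, flatv⟫ :=
    g.hasTemperateGrowth.comp ((innerSL ℝ).flip flatv).hasTemperateGrowth
  set K : 𝓢(EuclideanSpace ℝ (Fin N × Fin (d + 1)), ℂ) :=
    SchwartzMap.smulLeftCLM ℂ (fun P => g ⟪P, flatv⟫) G₀ with hKdef
  have hK : ∀ P, K P = ∫ s : ℝ, (𝓕⁻ g : 𝓢(ℝ, ℂ)) s * Ψf s P := by
    intro P
    rw [hKdef, SchwartzMap.smulLeftCLM_apply_apply hm, smul_eq_mul]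
    have hΨP : ∀ s : ℝ, Ψf s P = (𝐞 (-(s * ⟪P, flatv⟫)) : ℂ) * G₀ P := fun s => by
      change (𝓕 (SchwartzMap.compSubConstCLM ℂ (vmap s) Gf)) P = _
      rw [WightmanFamily.fourier_compSubConstCLM_apply]
      have : ⟪vmap s, P⟫ = s * ⟪P, flatv⟫ := by
        rw [hvmap, ContinuousLinearMap.toSpanSingleton_apply, real_inner_smul_left, real_inner_comm]
      rw [this]; rfl
    simp only [hΨP, ← mul_assoc]
    rw [integral_mul_const]
    congr 1
    -- `∫ 𝓕⁻¹g(s) e^{-2πi s ξ} ds = g ξ`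
    have h1 : (𝓕 (⇑(𝓕⁻ g : 𝓢(ℝ, ℂ)))) ⟪P, flatv⟫ =
        ∫ s : ℝ, (𝓕⁻ g : 𝓢(ℝ, ℂ)) s * (𝐞 (-(s * ⟪P, flatv⟫)) : ℂ) := by
      rw [Real.fourier_real_eq]
      refine integral_congr_ae (Eventually.of_forall fun s => ?_)
      simp only [Circle.smul_def, smul_eq_mul]; ring
    rw [← h1, ← SchwartzMap.fourier_coe, FourierInvPair.fourier_fourierInv_eq]
  -- hypotheses of the exchange theorem
  have hΨc : Continuous Ψf :=
    FT.continuous.comp ((continuous_compSubConstCLM ℂ Gf).comp vmap.continuous)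
  have hgrowth : ∀ k n' : ℕ, ∃ (C : ℝ) (N' : ℕ), ∀ s : ℝ,
      SchwartzMap.seminorm ℂ k n' (Ψf s) ≤ C * (1 + ‖s‖) ^ N' := fun k n' =>
    SchwartzMap.exists_seminorm_clm_compSubConstCLM_le FT Gf vmap k n'
  have hw : Continuous fun s : ℝ => (𝓕⁻ g : 𝓢(ℝ, ℂ)) s := (𝓕⁻ g : 𝓢(ℝ, ℂ)).continuous
  have hwi : ∀ N' : ℕ, Integrable (fun s : ℝ => (1 + ‖s‖) ^ N' * ‖(𝓕⁻ g : 𝓢(ℝ, ℂ)) s‖) :=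
    fun N' => SchwartzMap.integrable_one_add_norm_pow_mul (𝓕⁻ g : 𝓢(ℝ, ℂ)) N'
  have hex := SchwartzMap.apply_eq_integral_of_forall_apply_eq_integral S Ψf hΨc hgrowth _ hw hwi K hK
  simp only [hSΨ] at hex
  rw [← hex]
  -- `S K` is the left-hand side
  rfl

/-- **Translation invariance kills the diagonal part of the spectrum, cut-off form**: if
`T(Ψ(· − a)) = T(Ψ)` for all diagonal translations `a`, then for `θ ∈ C_c^∞(ℝ)` supported in
`{r ≠ 0}`, `T(unflatten 𝓕⁻¹(θ(⟨·, ẽ_μ^diag⟩) G)) = 0` (the exchange formula turns the left-hand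
side into `θ(0) T(unflatten 𝓕⁻¹ G) = 0`). [folklore] -/
theorem apply_unflatten_fourierInv_cutoff_diag_eq_zero_of_translate
    (T : 𝓢((Fin N → SpaceTime d), ℂ) →L[ℂ] ℂ)
    (hT : ∀ (a : SpaceTime d) (Ψ : 𝓢((Fin N → SpaceTime d), ℂ)), T (translateMulti a Ψ) = T Ψ)
    (μ : Fin (d + 1)) (θ : 𝓢(ℝ, ℂ)) (hθ0 : θ 0 = 0)
    (G : 𝓢(EuclideanSpace ℝ (Fin N × Fin (d + 1)), ℂ)) :
    T (SchwartzMap.compCLMOfContinuousLinearEquiv ℂ (flattenCLE d N)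
      (𝓕⁻ (SchwartzMap.smulLeftCLM ℂ (fun w => θ ⟪w, flattenCLE d N
        (fun _ : Fin N => EuclideanSpace.single μ (1 : ℝ))⟫) G))) = 0 := by
  set Ψ : 𝓢((Fin N → SpaceTime d), ℂ) :=
    SchwartzMap.compCLMOfContinuousLinearEquiv ℂ (flattenCLE d N) (𝓕⁻ G) with hΨ
  have hG : 𝓕 (flattenTest Ψ) = G := by
    have : flattenTest Ψ = 𝓕⁻ G := by ext Y; simp [hΨ]
    rw [this, FourierInvPair.fourier_fourierInv_eq]
  have h := apply_unflatten_fourierInv_smulLeftCLM_eq_integral T (fun _ : Fin N => EuclideanSpace.single μ (1 : ℝ)) θ Ψ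
  rw [hG] at h
  rw [h]
  have hconst : ∀ s : ℝ, T (SchwartzMap.compSubConstCLM ℂ (s • fun _ : Fin N => EuclideanSpace.single μ (1 : ℝ)) Ψ) = T Ψ := by
    intro s
    have : SchwartzMap.compSubConstCLM ℂ (s • fun _ : Fin N => EuclideanSpace.single μ (1 : ℝ)) Ψ =
        translateMulti (s • EuclideanSpace.single μ (1 : ℝ)) Ψ := by
      ext x; rw [SchwartzMap.compSubConstCLM_apply, translateMulti_apply]; rfl
    rw [this, hT]
  simp only [hconst, integral_mul_const, integral_fourierInv_eq_apply_zero, hθ0, zero_mul]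

end Exchange

/-! ### Paley–Wiener for the OS boundary values -/

section PaleyWiener

variable {m n : ℕ} [NeZero d] {S : SchwingerFamily (EuclideanSpace ℝ (Fin (d + 1)))}
  {𝔚 : (n : ℕ) → (Fin n → Fin (d + 1) → ℂ) → ℂ}

/-- **Paley–Wiener at level `s`**: for `g ∈ 𝓢(ℝ)` with compact support in `[0, ∞)` and compactly
supported `F`, `G`, `∫ 𝓕⁻¹g(t) ⟪b_F, U(t) b_G⟫ dt = 0` — the matrix element of the unitary time
group extends boundedly and holomorphically to the upper half-plane through the contraction
semigroup `e^{-τH}` (`τ = −il`), `R_g = laplaceExt g` decays there like `(1 + |l|)⁻²`, and the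
line of integration can be pushed to `+i∞`. [cite: OsterwalderSchraderCMP1973, §4.1 eqs. (4.5)–(4.11)] -/
theorem GlaserHyp.integral_fourierInv_mul_inner_timeGroupOp_eq_zero (h : GlaserHyp S 𝔚) (hE2 : S.IsOSReflectionPositive)
    {s : ℝ} (hs : 0 < s) (F : 𝓢((Fin n → SpaceTime d), ℂ)) (hFc : HasCompactSupport (F : (Fin n → SpaceTime d) → ℂ))
    (G : 𝓢((Fin m → SpaceTime d), ℂ)) (hGc : HasCompactSupport (G : (Fin m → SpaceTime d) → ℂ))
    (g : 𝓢(ℝ, ℂ)) (hgc : HasCompactSupport (g : ℝ → ℂ)) (hg0 : tsupport (g : ℝ → ℂ) ⊆ Ici 0) :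
    ∫ t : ℝ, (𝓕⁻ g : 𝓢(ℝ, ℂ)) t *
      ⟪h.glaserVec hE2 ⟨n, Smearing.ofRay hs F F.continuous hFc⟩, timeGroupOp (hE2 := hE2) h.covariant t
        (h.glaserVec hE2 ⟨m, Smearing.ofRay hs G G.continuous hGc⟩)⟫_ℂ = 0 := by
  set a := h.glaserVec hE2 ⟨n, Smearing.ofRay hs F F.continuous hFc⟩ with ha
  set b := h.glaserVec hE2 ⟨m, Smearing.ofRay hs G G.continuous hGc⟩ with hb
  set sf := rayShiftFam s hs G G.continuous hGc with hsf
  -- the holomorphic function on `{Im l > -s}`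
  set Kf : ℂ → ℂ := fun l => smKernel 𝔚 ⟨n, Smearing.ofRay hs F F.continuous hFc⟩ ⟨m, sf.eval l⟩ with hKf
  have hKf_diff : DifferentiableOn ℂ Kf {l : ℂ | -s < l.im} :=
    h.differentiableOn_smKernel_eval (Smearing.ofRay hs F F.continuous hFc) sf
  -- on `{Im l ≥ 0}` it is the matrix element of `e^{-(-il)H}`
  have hKf_eq : ∀ l : ℂ, 0 ≤ l.im → Kf l = ⟪a, holoShiftH (hE2 := hE2) h.covariant (-(I * l)) b⟫_ℂ := by
    intro l hl
    have := h.inner_holoShiftH_glaserVec_ofRay hE2 (Smearing.ofRay hs F F.continuous hFc) hs G hGc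
      (τ' := -(I * l)) (by simpa using hl)
    have hl' : I * -(I * l) = l := by ring_nf; rw [I_sq]; ring
    rw [hl'] at this
    exact this.symm
  have hKf_bound : ∀ l : ℂ, 0 ≤ l.im → ‖Kf l‖ ≤ ‖a‖ * ‖b‖ := by
    intro l hl
    rw [hKf_eq l hl]
    refine (norm_inner_le_norm _ _).trans (mul_le_mul_of_nonneg_left ?_ (norm_nonneg _))
    exact OSSpace.norm_holoShiftH_apply_le h.covariant (by simpa using hl) _
  -- the decay of `laplaceExt g`
  obtain ⟨C, hC0, hC⟩ := exists_norm_laplaceExt_le g hgc hg0 2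
  have hΦ := integral_eq_zero_of_norm_le_upperHalfPlane (fun l => Kf l * laplaceExt g l)
    ((hKf_diff.mono fun l hl => by simp only [mem_setOf_eq] at hl ⊢; linarith).mul
      (differentiable_laplaceExt hgc g.integrable).differentiableOn) (A := ‖a‖ * ‖b‖ * C)
    (fun l hl => by
      rw [norm_mul, mul_assoc]
      exact mul_le_mul (hKf_bound l hl) (hC l hl) (norm_nonneg _) (by positivity))
  -- on the real axis
  have hreal : ∀ t : ℝ, Kf t * laplaceExt g t = (𝓕⁻ g : 𝓢(ℝ, ℂ)) t * ⟪a, timeGroupOp (hE2 := hE2) h.covariant t b⟫_ℂ := by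
    intro t
    rw [laplaceExt_ofReal, SchwartzMap.fourierInv_coe, mul_comm]
    congr 1
    rw [hKf]
    exact (h.inner_timeGroupOp_glaserVec_ofRay hE2 _ hs G hGc t).symm
  simp only [hreal] at hΦ
  exact hΦ

omit [NeZero d] in
/-- The regularised pairings `∫ 𝔚_{n+m}(X + isη^{nm}) Ψ(X) dX` tend to the boundary value. [folklore] -/
theorem tendsto_integral_rayConfig_pairDir {T : 𝓢((Fin (n + m) → SpaceTime d), ℂ) →L[ℂ] ℂ}
    (hbv : HasDistributionalBoundaryValue (𝔚 (n + m)) T) (Ψ : 𝓢((Fin (n + m) → SpaceTime d), ℂ)) :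
    Tendsto (fun s : ℝ => ∫ X, 𝔚 (n + m) (rayConfig (pairDir d n m) X s) * Ψ X) (𝓝[>] 0) (𝓝 (T Ψ)) :=
  hbv _ pairDir_mem_tubeCone Ψ

/-- **Paley–Wiener for the OS boundary values** (the `s → 0⁺` limit of the level-`s` statement):
for compactly supported `F`, `G` and `g ∈ 𝓢(ℝ)` with compact support in `[0, ∞)`,
`∫ 𝓕⁻¹g(t) 𝒲_{n+m}(F^† ⊗ G(· − t ê₀)) dt = 0`. [cite: OsterwalderSchraderCMP1973, §4.1 p. 93] -/
theorem integral_fourierInv_mul_apply_appendTensor_translate_eq_zero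
    {𝒲 : WightmanFamily d Unit} (hE1 : S.IsEuclideanCovariant) (hE2 : S.IsOSReflectionPositive)
    (h𝒲 : IsOSContinuationFamily S 𝒲)
    (F : 𝓢((Fin n → SpaceTime d), ℂ)) (hFc : HasCompactSupport (F : (Fin n → SpaceTime d) → ℂ))
    (G : 𝓢((Fin m → SpaceTime d), ℂ)) (hGc : HasCompactSupport (G : (Fin m → SpaceTime d) → ℂ))
    (g : 𝓢(ℝ, ℂ)) (hgc : HasCompactSupport (g : ℝ → ℂ)) (hg0 : tsupport (g : ℝ → ℂ) ⊆ Ici 0) :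
    ∫ t : ℝ, (𝓕⁻ g : 𝓢(ℝ, ℂ)) t * 𝒲 (n + m) (fun _ => ())
      (SchwartzMap.appendTensor (starTest (permTest Fin.revPerm F)) (translateMulti (t • e₀ d) G)) = 0 := by
  obtain ⟨𝔚, h, hbv⟩ := h𝒲.exists_glaserHyp hE1
  set T := 𝒲 (n + m) (fun _ => ()) with hT
  set Ψ : ℝ → 𝓢((Fin (n + m) → SpaceTime d), ℂ) := fun t =>
    SchwartzMap.appendTensor (starTest (permTest Fin.revPerm F)) (translateMulti (t • e₀ d) G) with hΨ
  -- the regularised pairings and their two expressions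
  set hs_ : ℝ → ℝ → ℂ := fun s t => ∫ X, 𝔚 (n + m) (rayConfig (pairDir d n m) X s) * Ψ t X with hhs
  have hinner : ∀ {s : ℝ} (hs : 0 < s) (t : ℝ), hs_ s t =
      ⟪h.glaserVec hE2 ⟨n, Smearing.ofRay hs F F.continuous hFc⟩, timeGroupOp (hE2 := hE2) h.covariant t
        (h.glaserVec hE2 ⟨m, Smearing.ofRay hs G G.continuous hGc⟩)⟫_ℂ :=
    fun hs t => (h.inner_timeGroupOp_glaserVec_ofRay_ofRay hE2 hs F hFc G hGc t).symm
  -- (1) at every level `s > 0` the weighted integral vanishes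
  have hlevel : ∀ {s : ℝ} (hs : 0 < s), ∫ t : ℝ, (𝓕⁻ g : 𝓢(ℝ, ℂ)) t * hs_ s t = 0 := by
    intro s hs
    simp only [hinner hs]
    exact h.integral_fourierInv_mul_inner_timeGroupOp_eq_zero hE2 hs F hFc G hGc g hgc hg0
  -- (2) pointwise limit `s → 0⁺`
  have hpt : ∀ t, Tendsto (fun s => hs_ s t) (𝓝[>] 0) (𝓝 (T (Ψ t))) := fun t =>
    tendsto_integral_rayConfig_pairDir (hbv (n + m)) (Ψ t)
  -- (3) a uniform bound near `s = 0⁺` from the norms of the Glaser vectors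
  have hnormF : Tendsto (fun s : ℝ => ∫ X, 𝔚 (n + n) (rayConfig (pairDir d n n) X s) *
      SchwartzMap.appendTensor (starTest (permTest Fin.revPerm F)) F X) (𝓝[>] 0)
      (𝓝 (𝒲 (n + n) (fun _ => ()) (SchwartzMap.appendTensor (starTest (permTest Fin.revPerm F)) F))) :=
    tendsto_integral_rayConfig_pairDir (hbv (n + n)) _
  have hnormG : Tendsto (fun s : ℝ => ∫ X, 𝔚 (m + m) (rayConfig (pairDir d m m) X s) *
      SchwartzMap.appendTensor (starTest (permTest Fin.revPerm G)) G X) (𝓝[>] 0)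
      (𝓝 (𝒲 (m + m) (fun _ => ()) (SchwartzMap.appendTensor (starTest (permTest Fin.revPerm G)) G))) :=
    tendsto_integral_rayConfig_pairDir (hbv (m + m)) _
  set LF : ℝ := ‖𝒲 (n + n) (fun _ => ()) (SchwartzMap.appendTensor (starTest (permTest Fin.revPerm F)) F)‖ + 1 with hLF
  set LG : ℝ := ‖𝒲 (m + m) (fun _ => ()) (SchwartzMap.appendTensor (starTest (permTest Fin.revPerm G)) G)‖ + 1 with hLG
  have hevF : ∀ᶠ s in 𝓝[>] (0 : ℝ), ‖∫ X, 𝔚 (n + n) (rayConfig (pairDir d n n) X s) *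
      SchwartzMap.appendTensor (starTest (permTest Fin.revPerm F)) F X‖ < LF :=
    (hnormF.norm).eventually (gt_mem_nhds (by rw [hLF]; linarith))
  have hevG : ∀ᶠ s in 𝓝[>] (0 : ℝ), ‖∫ X, 𝔚 (m + m) (rayConfig (pairDir d m m) X s) *
      SchwartzMap.appendTensor (starTest (permTest Fin.revPerm G)) G X‖ < LG :=
    (hnormG.norm).eventually (gt_mem_nhds (by rw [hLG]; linarith))
  have hbound : ∀ᶠ s in 𝓝[>] (0 : ℝ), ∀ t, ‖hs_ s t‖ ≤ Real.sqrt LF * Real.sqrt LG := by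
    filter_upwards [hevF, hevG, self_mem_nhdsWithin] with s hsF hsG hs
    intro t
    have hs' : 0 < s := hs
    rw [hinner hs']
    have hna : ‖h.glaserVec hE2 ⟨n, Smearing.ofRay hs' F F.continuous hFc⟩‖ ≤ Real.sqrt LF := by
      rw [← Real.sqrt_sq (norm_nonneg _)]
      refine Real.sqrt_le_sqrt ?_
      have := h.norm_glaserVec_ofRay_sq hE2 hs' F hFc
      have h1 : ‖(((‖h.glaserVec hE2 ⟨n, Smearing.ofRay hs' F F.continuous hFc⟩‖ ^ 2 : ℝ) : ℂ))‖ < LF := by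
        rw [this]; exact hsF
      rw [Complex.norm_real, Real.norm_eq_abs, abs_of_nonneg (sq_nonneg _)] at h1
      exact h1.le
    have hnb : ‖h.glaserVec hE2 ⟨m, Smearing.ofRay hs' G G.continuous hGc⟩‖ ≤ Real.sqrt LG := by
      rw [← Real.sqrt_sq (norm_nonneg _)]
      refine Real.sqrt_le_sqrt ?_
      have := h.norm_glaserVec_ofRay_sq hE2 hs' G hGc
      have h1 : ‖(((‖h.glaserVec hE2 ⟨m, Smearing.ofRay hs' G G.continuous hGc⟩‖ ^ 2 : ℝ) : ℂ))‖ < LG := by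
        rw [this]; exact hsG
      rw [Complex.norm_real, Real.norm_eq_abs, abs_of_nonneg (sq_nonneg _)] at h1
      exact h1.le
    calc ‖⟪h.glaserVec hE2 ⟨n, Smearing.ofRay hs' F F.continuous hFc⟩, timeGroupOp (hE2 := hE2) h.covariant t
          (h.glaserVec hE2 ⟨m, Smearing.ofRay hs' G G.continuous hGc⟩)⟫_ℂ‖
        ≤ ‖h.glaserVec hE2 ⟨n, Smearing.ofRay hs' F F.continuous hFc⟩‖ *
            ‖timeGroupOp (hE2 := hE2) h.covariant t (h.glaserVec hE2 ⟨m, Smearing.ofRay hs' G G.continuous hGc⟩)‖ :=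
          norm_inner_le_norm _ _
      _ = ‖h.glaserVec hE2 ⟨n, Smearing.ofRay hs' F F.continuous hFc⟩‖ *
            ‖h.glaserVec hE2 ⟨m, Smearing.ofRay hs' G G.continuous hGc⟩‖ := by
          rw [OSSpace.norm_timeGroupOp_apply]
      _ ≤ Real.sqrt LF * Real.sqrt LG :=
          mul_le_mul hna hnb (norm_nonneg _) (Real.sqrt_nonneg _)
  -- (4) measurability in `t`: for `s > 0`, `t ↦ hs_ s t` is continuous (strongly continuous group)
  have hmeas : ∀ᶠ s in 𝓝[>] (0 : ℝ), AEStronglyMeasurable (fun t => (𝓕⁻ g : 𝓢(ℝ, ℂ)) t * hs_ s t) volume := by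
    filter_upwards [self_mem_nhdsWithin] with s hs
    have hs' : 0 < s := hs
    have hc : Continuous fun t => hs_ s t := by
      simp only [hinner hs']
      exact continuous_const.inner (OSSpace.continuous_timeGroupOp_apply h.covariant _)
    exact ((𝓕⁻ g : 𝓢(ℝ, ℂ)).continuous.mul hc).aestronglyMeasurable
  -- (5) dominated convergence in `t`
  have hlim : Tendsto (fun s => ∫ t : ℝ, (𝓕⁻ g : 𝓢(ℝ, ℂ)) t * hs_ s t) (𝓝[>] 0)
      (𝓝 (∫ t : ℝ, (𝓕⁻ g : 𝓢(ℝ, ℂ)) t * T (Ψ t))) := by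
    refine tendsto_integral_filter_of_dominated_convergence
      (fun t => Real.sqrt LF * Real.sqrt LG * ‖(𝓕⁻ g : 𝓢(ℝ, ℂ)) t‖) hmeas ?_ ?_ ?_
    · filter_upwards [hbound] with s hsb
      refine Eventually.of_forall fun t => ?_
      rw [norm_mul]
      nlinarith [hsb t, norm_nonneg ((𝓕⁻ g : 𝓢(ℝ, ℂ)) t), norm_nonneg (hs_ s t)]
    · exact ((𝓕⁻ g : 𝓢(ℝ, ℂ)).integrable.norm).const_mul _
    · exact Eventually.of_forall fun t => tendsto_const_nhds.mul (hpt t)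
  have hzero : Tendsto (fun s => ∫ t : ℝ, (𝓕⁻ g : 𝓢(ℝ, ℂ)) t * hs_ s t) (𝓝[>] 0) (𝓝 0) := by
    refine tendsto_const_nhds.congr' ?_
    filter_upwards [self_mem_nhdsWithin] with s hs
    exact (hlevel hs).symm
  exact tendsto_nhds_unique hlim hzero

end PaleyWiener

/-! ### Totality of compactly supported two-block tensors -/

section Density

variable {a b : ℕ}

/-- A full tensor product splits as a two-block tensor. [folklore] -/
theorem tensorFin_eq_appendTensor (f : Fin (a + b) → 𝓢(SpaceTime d, ℂ)) :
    SchwartzMap.tensorFin (a + b) f =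
      SchwartzMap.appendTensor (SchwartzMap.tensorFin a (fun i => f (Fin.castAdd b i)))
        (SchwartzMap.tensorFin b (fun j => f (Fin.natAdd a j))) := by
  ext x
  rw [SchwartzMap.tensorFin_apply, SchwartzMap.appendTensor_apply, SchwartzMap.tensorFin_apply,
    SchwartzMap.tensorFin_apply, Fin.prod_univ_add]
  rfl

variable (d a b) in
/-- The set of two-block tensors `A ⊗ B` of compactly supported test functions. [folklore] -/
def cptTwoBlockTensors : Set 𝓢((Fin (a + b) → SpaceTime d), ℂ) :=
  {Ψ | ∃ (A : 𝓢((Fin a → SpaceTime d), ℂ)) (B : 𝓢((Fin b → SpaceTime d), ℂ)),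
    HasCompactSupport (A : (Fin a → SpaceTime d) → ℂ) ∧ HasCompactSupport (B : (Fin b → SpaceTime d) → ℂ) ∧
      Ψ = SchwartzMap.appendTensor A B}

/-- **The compactly supported two-block tensors are total** in `𝒮((ℝ^{1+d})^{a+b})`: a full
tensor `⊗ fⱼ` is `(⊗_{j<a} fⱼ) ⊗ (⊗_{j≥a} fⱼ)`, compactly supported cut-offs of the two factors
converge, and full tensors are total (`denseSpan_tensorProducts_holds`). [folklore] -/
theorem dense_span_cptTwoBlockTensors :
    Dense (Submodule.span ℂ (cptTwoBlockTensors d a b) : Set 𝓢((Fin (a + b) → SpaceTime d), ℂ)) := by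
  have hfull := denseSpan_tensorProducts_holds (E := SpaceTime d) (a + b)
  have hsub : (Submodule.span ℂ (tensorProducts (E := SpaceTime d) (a + b)) : Set _) ⊆
      closure (Submodule.span ℂ (cptTwoBlockTensors d a b) : Set 𝓢((Fin (a + b) → SpaceTime d), ℂ)) := by
    rw [← Submodule.topologicalClosure_coe]
    refine Submodule.span_le.2 fun Ψ hΨ => ?_
    obtain ⟨f, hf⟩ := mem_tensorProducts.1 hΨ
    have hΨeq : Ψ = SchwartzMap.tensorFin (a + b) (fun i => ofRealTest (f i)) := by
      ext x; rw [hf x, SchwartzMap.tensorFin_apply]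
    rw [hΨeq, tensorFin_eq_appendTensor]
    set A := SchwartzMap.tensorFin a (fun i => ofRealTest (f (Fin.castAdd b i)))
    set B := SchwartzMap.tensorFin b (fun j => ofRealTest (f (Fin.natAdd a j)))
    obtain ⟨uA, huA, huAt⟩ := exists_tsupport_subset_closedBall_tendsto A
    obtain ⟨uB, huB, huBt⟩ := exists_tsupport_subset_closedBall_tendsto B
    rw [Submodule.topologicalClosure_coe]
    refine mem_closure_of_tendsto (SchwartzMap.tendsto_appendTensor huAt huBt)
      (Eventually.of_forall fun k => Submodule.subset_span ⟨uA k, uB k, ?_, ?_, rfl⟩)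
    · exact (isCompact_closedBall _ _).of_isClosed_subset (isClosed_tsupport _) (huA k)
    · exact (isCompact_closedBall _ _).of_isClosed_subset (isClosed_tsupport _) (huB k)
  rw [dense_iff_closure_eq] at hfull ⊢
  apply eq_univ_of_univ_subset
  rw [← hfull]
  exact closure_minimal hsub isClosed_closure

end Density

/-! ### Vanishing of the Fourier transform on `{(∑_{j>k} pⱼ)⁰ > 0}` -/

section Upper

variable {a b : ℕ} [NeZero d] {S : SchwingerFamily (EuclideanSpace ℝ (Fin (d + 1)))}
  {𝒲 : WightmanFamily d Unit}

omit [NeZero d] in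
/-- The block-`B` time direction `(0, …, 0, ê₀, …, ê₀)`. [folklore] -/
theorem smul_diagVec_e₀ (t : ℝ) :
    t • WightmanFamily.diagVec d a b (e₀ d) = WightmanFamily.diagVec d a b (t • e₀ d) := by
  funext i
  refine Fin.addCases (fun j => ?_) (fun j => ?_) i <;> simp [WightmanFamily.diagVec]

/-- **Vanishing on `{(∑_{j ≥ a} pⱼ)⁰ > 0}`, two-block form**: for an OS continuation family, `θ`
Schwartz with compact support in `[0, ∞)` and every `Ĝ` on the Fourier side,
`𝒲_{a+b}(unflatten 𝓕⁻¹(θ(⟨·, ṽ⟩) Ĝ)) = 0` with `v = (0, …, 0, ê₀, …, ê₀)` (Paley–Wiener on the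
compactly supported two-block tensors, which are total). [cite: OsterwalderSchraderCMP1973, §4.1 p. 93] -/
theorem IsOSContinuationFamily.apply_unflatten_fourierInv_upper_eq_zero (hE1 : S.IsEuclideanCovariant)
    (hE2 : S.IsOSReflectionPositive) (h𝒲 : IsOSContinuationFamily S 𝒲)
    (θ : 𝓢(ℝ, ℂ)) (hθc : HasCompactSupport (θ : ℝ → ℂ)) (hθ0 : tsupport (θ : ℝ → ℂ) ⊆ Ici 0)
    (G : 𝓢(EuclideanSpace ℝ (Fin (a + b) × Fin (d + 1)), ℂ)) :
    𝒲 (a + b) (fun _ => ()) (SchwartzMap.compCLMOfContinuousLinearEquiv ℂ (flattenCLE d (a + b))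
      (𝓕⁻ (SchwartzMap.smulLeftCLM ℂ (fun w => θ ⟪w, flattenCLE d (a + b)
        (WightmanFamily.diagVec d a b (e₀ d))⟫) G))) = 0 := by
  set T := 𝒲 (a + b) (fun _ => ()) with hT
  set v : Fin (a + b) → SpaceTime d := WightmanFamily.diagVec d a b (e₀ d) with hv
  -- the functional `Ψ ↦ T(unflatten 𝓕⁻¹(θ(⟨·, ṽ⟩) 𝓕Ψ̃))`
  have hm : Function.HasTemperateGrowth fun w : EuclideanSpace ℝ (Fin (a + b) × Fin (d + 1)) =>
      θ ⟪w, flattenCLE d (a + b) v⟫ :=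
    θ.hasTemperateGrowth.comp ((innerSL ℝ).flip (flattenCLE d (a + b) v)).hasTemperateGrowth
  set Λ : 𝓢((Fin (a + b) → SpaceTime d), ℂ) →L[ℂ] ℂ :=
    T.comp ((SchwartzMap.compCLMOfContinuousLinearEquiv ℂ (flattenCLE d (a + b))).comp
      ((FourierTransform.fourierInvCLM ℂ (𝓢(EuclideanSpace ℝ (Fin (a + b) × Fin (d + 1)), ℂ))).comp
        ((SchwartzMap.smulLeftCLM ℂ (fun w : EuclideanSpace ℝ (Fin (a + b) × Fin (d + 1)) =>
          θ ⟪w, flattenCLE d (a + b) v⟫)).comp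
          ((SchwartzMap.fourierTransformCLM ℂ).comp flattenTest)))) with hΛdef
  have hΛ : ∀ Ψ, Λ Ψ = T (SchwartzMap.compCLMOfContinuousLinearEquiv ℂ (flattenCLE d (a + b))
      (𝓕⁻ (SchwartzMap.smulLeftCLM ℂ (fun w => θ ⟪w, flattenCLE d (a + b) v⟫) (𝓕 (flattenTest Ψ))))) :=
    fun Ψ => rfl
  -- `Λ` vanishes on compactly supported two-block tensors
  have hvan : ∀ Ψ ∈ cptTwoBlockTensors d a b, Λ Ψ = 0 := by
    rintro Ψ ⟨A, B, hA, hB, rfl⟩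
    rw [hΛ, apply_unflatten_fourierInv_smulLeftCLM_eq_integral]
    have htr : ∀ s : ℝ, SchwartzMap.compSubConstCLM ℂ (s • v) (SchwartzMap.appendTensor A B) =
        SchwartzMap.appendTensor (starTest (permTest Fin.revPerm (starTest (permTest Fin.revPerm A))))
          (translateMulti (s • e₀ d) B) := by
      intro s
      rw [starTest_permTest_revPerm_involutive, WightmanFamily.appendTensor_translateMulti, hv, smul_diagVec_e₀]
    simp only [htr]
    exact integral_fourierInv_mul_apply_appendTensor_translate_eq_zero hE1 hE2 h𝒲 _
      (hasCompactSupport_starTest_permTest_revPerm hA) B hB θ hθc hθ0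
  -- hence everywhere
  have hΛ0 : Λ = 0 :=
    ContinuousLinearMap.ext_on dense_span_cptTwoBlockTensors fun Ψ hΨ => by
      rw [hvan Ψ hΨ]; rfl
  -- evaluate at `unflatten 𝓕⁻¹ G`
  set Ψ₀ : 𝓢((Fin (a + b) → SpaceTime d), ℂ) :=
    SchwartzMap.compCLMOfContinuousLinearEquiv ℂ (flattenCLE d (a + b)) (𝓕⁻ G) with hΨ₀
  have hG : 𝓕 (flattenTest Ψ₀) = G := by
    have : flattenTest Ψ₀ = 𝓕⁻ G := by ext Y; simp [hΨ₀]
    rw [this, FourierInvPair.fourier_fourierInv_eq]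
  have := hΛ Ψ₀
  rw [hG, hΛ0] at this
  exact this.symm

/-- **Vanishing on `V_k = {(∑_{j>k} pⱼ)⁰ > 0}`**, in the cut-off form of
`fourierSupportedIn_halfSpectralSet_of_tendsto` (`OSTimeContinuationProofs`), for an arbitrary
`N` and `k : Fin N` (reduction to the two-block form `N = (k+1) + b`). [cite: OsterwalderSchraderCMP1973, §4.1 p. 93] -/
theorem IsOSContinuationFamily.apply_unflatten_fourierInv_cutoff_upper_eq_zero {N : ℕ}
    (hE1 : S.IsEuclideanCovariant) (hE2 : S.IsOSReflectionPositive) (h𝒲 : IsOSContinuationFamily S 𝒲)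
    (k : Fin N) {θ : ℝ → ℝ} (hθ : ContDiff ℝ ∞ θ) (hθc : HasCompactSupport θ) (hθW : tsupport θ ⊆ Ioi 0)
    (G : 𝓢(EuclideanSpace ℝ (Fin N × Fin (d + 1)), ℂ)) :
    𝒲 N (fun _ => ()) (SchwartzMap.compCLMOfContinuousLinearEquiv ℂ (flattenCLE d N)
      (𝓕⁻ (SchwartzMap.smulLeftCLM ℂ (fun w =>
        ((θ ⟪w, flattenCLE d N (fun j : Fin N => if k < j then e₀ d else 0)⟫ : ℝ) : ℂ)) G))) = 0 := by
  -- the complex Schwartz cut-off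
  set θc : ℝ → ℂ := fun r => (θ r : ℂ) with hθc_def
  have hθcs : ContDiff ℝ ∞ θc := Complex.ofRealCLM.contDiff.comp hθ
  have hθcc : HasCompactSupport θc := hθc.comp_left Complex.ofReal_zero
  set θS : 𝓢(ℝ, ℂ) := hθcc.toSchwartzMap hθcs with hθS
  have hθS_apply : ∀ r, θS r = (θ r : ℂ) := fun r => rfl
  have hθS0 : tsupport (θS : ℝ → ℂ) ⊆ Ici 0 :=
    ((tsupport_comp_subset Complex.ofReal_zero _).trans hθW).trans Ioi_subset_Ici_self
  have hθSc : HasCompactSupport (θS : ℝ → ℂ) := hθcc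
  -- reduce `N` to `(k + 1) + b`
  obtain ⟨kv, hkv⟩ : ∃ kv : ℕ, (k : ℕ) = kv := ⟨k, rfl⟩
  have hlt : ∀ j : Fin N, (k < j) = (kv < (j : ℕ)) := fun j => by rw [Fin.lt_def, hkv]
  simp only [hlt]
  have hkN : kv + 1 ≤ N := by rw [← hkv]; exact k.2
  clear hlt hkv k
  obtain ⟨b, rfl⟩ : ∃ b, N = (kv + 1) + b := ⟨N - (kv + 1), by omega⟩
  have hvec : (fun j : Fin (kv + 1 + b) => if kv < (j : ℕ) then e₀ d else 0) =
      WightmanFamily.diagVec d (kv + 1) b (e₀ d) := by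
    funext j
    refine Fin.addCases (fun i => ?_) (fun i => ?_) j
    · have : ¬ kv < (i : ℕ) := not_lt.2 (Nat.lt_succ_iff.1 i.2)
      simp [WightmanFamily.diagVec, this]
    · have : kv < kv + 1 + (i : ℕ) := by omega
      simp [WightmanFamily.diagVec, this]
  have hfun : (fun w : EuclideanSpace ℝ (Fin (kv + 1 + b) × Fin (d + 1)) =>
      ((θ ⟪w, flattenCLE d (kv + 1 + b) (fun j : Fin (kv + 1 + b) => if kv < (j : ℕ) then e₀ d else 0)⟫ : ℝ) : ℂ)) =
      fun w => θS ⟪w, flattenCLE d (kv + 1 + b) (WightmanFamily.diagVec d (kv + 1) b (e₀ d))⟫ := by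
    funext w; rw [hθS_apply, hvec]
  rw [hfun]
  exact h𝒲.apply_unflatten_fourierInv_upper_eq_zero hE1 hE2 θS hθSc hθS0 G

end Upper

/-! ### The half-space spectral support and the discharges -/

section Assembly

variable [NeZero d] {S : SchwingerFamily (EuclideanSpace ℝ (Fin (d + 1)))} {𝒲 : WightmanFamily d Unit}

/-- **The Fourier transform of an OS continuation family is supported in the half-space spectral
set** `{∑ pⱼ = 0, (∑_{j ≤ k} pⱼ)⁰ ≥ 0}` (Osterwalder–Schrader I (1973), p. 93: "`W̃ₙ(q₁, …, qₙ)` is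
a distribution with support in `{q_k⁰ ≥ 0}`"), for *every* OS continuation family of an E1–E2
Schwinger family — from the positivity of the energy in the OS Hilbert space through the Glaser
vectors, the Paley–Wiener theorem and the sheaf property of supports; no growth estimate on the
continuation is used. [cite: OsterwalderSchraderCMP1973, §4.1 p. 93] -/
theorem IsOSContinuationFamily.fourierSupportedIn_halfSpectralSet (hE1 : S.IsEuclideanCovariant)
    (hE2 : S.IsOSReflectionPositive) (h𝒲 : IsOSContinuationFamily S 𝒲) (N : ℕ) :
    FourierSupportedIn (𝒲 N fun _ => ()) (halfSpectralSet d N) := by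
  set T := 𝒲 N (fun _ => ()) with hT
  -- the functional on the Fourier side
  set Φ : 𝓢(EuclideanSpace ℝ (Fin N × Fin (d + 1)), ℂ) →L[ℂ] 𝓢((Fin N → SpaceTime d), ℂ) :=
    (SchwartzMap.compCLMOfContinuousLinearEquiv ℂ (flattenCLE d N)).comp
      (FourierTransform.fourierInvCLM ℂ (𝓢(EuclideanSpace ℝ (Fin N × Fin (d + 1)), ℂ))) with hΦ
  set T' : 𝓢(EuclideanSpace ℝ (Fin N × Fin (d + 1)), ℂ) →L[ℂ] ℂ := T.comp Φ with hT'
  have hT'apply : ∀ ψ : 𝓢(EuclideanSpace ℝ (Fin N × Fin (d + 1)), ℂ),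
      T' ψ = T (SchwartzMap.compCLMOfContinuousLinearEquiv ℂ (flattenCLE d N) (𝓕⁻ ψ)) := fun ψ => rfl
  have hTF : ∀ F : 𝓢((Fin N → SpaceTime d), ℂ), T F = T' (𝓕 (flattenTest F)) := fun F => by
    simp only [hT', ContinuousLinearMap.comp_apply]
    congr 1
    ext x
    simp [hΦ]
  -- translation invariance of `T`
  have htr : ∀ (a' : SpaceTime d) (Ψ : 𝓢((Fin N → SpaceTime d), ℂ)), T (translateMulti a' Ψ) = T Ψ :=
    fun a' Ψ => h𝒲.translateMulti_eq hE1 N _ a' Ψ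
  -- the cover sets
  set mdiag : Fin (d + 1) → EuclideanSpace ℝ (Fin N × Fin (d + 1)) := fun μ =>
    flattenCLE d N (fun _ : Fin N => EuclideanSpace.single μ (1 : ℝ)) with hmdiag
  set mup : Fin N → EuclideanSpace ℝ (Fin N × Fin (d + 1)) := fun k =>
    flattenCLE d N (fun j : Fin N => if k < j then e₀ d else 0) with hmup
  set W : Fin (d + 1) ⊕ Fin N → Set (EuclideanSpace ℝ (Fin N × Fin (d + 1))) := fun i =>
    Sum.elim (fun μ => {w | ⟪w, mdiag μ⟫ ≠ 0}) (fun k => {w | 0 < ⟪w, mup k⟫}) i with hWdef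
  have hℓ : ∀ (m w : EuclideanSpace ℝ (Fin N × Fin (d + 1))), (innerSL ℝ).flip m w = ⟪w, m⟫ :=
    fun m w => by rw [ContinuousLinearMap.flip_apply, innerSL_apply_apply]
  have hWo : ∀ i, IsOpen (W i) := by
    rintro (μ | k)
    · exact isOpen_ne_fun (continuous_id.inner continuous_const) continuous_const
    · exact isOpen_lt continuous_const (continuous_id.inner continuous_const)
  have hWv : ∀ i, SchwartzSupport.IsVanishingOnCompact T' (W i) := by
    rintro (μ | k)
    · have hpre : W (Sum.inl μ) = ((innerSL ℝ).flip (mdiag μ)) ⁻¹' {r : ℝ | r ≠ 0} := by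
        ext w
        simp only [hWdef, Sum.elim_inl, mem_setOf_eq, mem_preimage, hℓ]
      rw [hpre]
      refine SchwartzSupport.isVanishingOnCompact_preimage T' _ isOpen_ne fun θ hθ hθc hθW G => ?_
      rw [hT'apply]
      -- the complex Schwartz cut-off, vanishing at `0`
      set θc : ℝ → ℂ := fun r => (θ r : ℂ) with hθc_def
      have hθcs : ContDiff ℝ ∞ θc := Complex.ofRealCLM.contDiff.comp hθ
      have hθcc : HasCompactSupport θc := hθc.comp_left Complex.ofReal_zero
      set θS : 𝓢(ℝ, ℂ) := hθcc.toSchwartzMap hθcs with hθS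
      have h0 : θS 0 = 0 := by
        have : (0 : ℝ) ∉ tsupport θ := fun h' => hθW h' rfl
        change (θ 0 : ℂ) = 0
        rw [image_eq_zero_of_notMem_tsupport this, Complex.ofReal_zero]
      have hfun : (fun w => ((θ ((innerSL ℝ).flip (mdiag μ) w) : ℝ) : ℂ)) =
          fun w => θS ⟪w, mdiag μ⟫ := by funext w; rw [hℓ]; rfl
      rw [hfun]
      exact apply_unflatten_fourierInv_cutoff_diag_eq_zero_of_translate T htr μ θS h0 G
    · have hpre : W (Sum.inr k) = ((innerSL ℝ).flip (mup k)) ⁻¹' Ioi 0 := by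
        ext w
        simp only [hWdef, Sum.elim_inr, mem_setOf_eq, mem_preimage, mem_Ioi, hℓ]
      rw [hpre]
      refine SchwartzSupport.isVanishingOnCompact_preimage T' _ isOpen_Ioi fun θ hθ hθc hθW G => ?_
      rw [hT'apply]
      have hfun : (fun w => ((θ ((innerSL ℝ).flip (mup k) w) : ℝ) : ℂ)) =
          fun w => ((θ ⟪w, mup k⟫ : ℝ) : ℂ) := by funext w; rw [hℓ]
      rw [hfun]
      exact h𝒲.apply_unflatten_fourierInv_cutoff_upper_eq_zero hE1 hE2 k hθ hθc hθW G
  have hglue : Distribution.IsVanishingOn (T' : 𝓢(EuclideanSpace ℝ (Fin N × Fin (d + 1)), ℂ) → ℂ)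
      (⋃ i, W i) := SchwartzSupport.isVanishingOn_iUnion T' hWo hWv
  have hcover : (flattenCLE d N '' halfSpectralSet d N)ᶜ ⊆ ⋃ i, W i := by
    intro w hw
    rcases compl_image_halfSpectralSet_subset hw with h | h
    · obtain ⟨μ, hμ⟩ := mem_iUnion.1 h
      exact mem_iUnion.2 ⟨Sum.inl μ, hμ⟩
    · obtain ⟨k, hk⟩ := mem_iUnion.1 h
      exact mem_iUnion.2 ⟨Sum.inr k, hk⟩
  intro F hF
  rw [hTF]
  exact hglue.mono hcover _ (subset_compl_iff_disjoint_right.2 hF)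

/-- **The spectral OS data of an OS family and any of its OS continuation families** (the bundle
of hypotheses `SpectralOSData` of `OSWightmanVectors`, now unconditional): the half-space support
upgraded to the spectral condition by the Lorentz invariance proved from E1
(`hasSpectralCondition_of_halfSpace`). [folklore] -/
theorem IsOSContinuationFamily.spectralOSData (hOS : S.IsOSFamily) (h𝒲 : IsOSContinuationFamily S 𝒲) :
    SpectralOSData S 𝒲 := by
  have hspec : HasSpectralCondition 𝒲 :=
    𝒲.hasSpectralCondition_of_halfSpace
      (fun n k => h𝒲.isLorentzInvariantDistribution hOS.covariant n k)
      (fun n k => by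
        obtain rfl := unitLabels_eq k
        exact h𝒲.fourierSupportedIn_halfSpectralSet hOS.covariant hOS.reflectionPositive n)
  exact ⟨hOS, h𝒲, fun n => hspec n _⟩

/-- **(R5) `OS1973_spectralCondition` holds**: the boundary values of an OS continuation family
satisfy the spectral condition (Osterwalder–Schrader I (1973), §4.1 p. 93 and §4.2). [cite: OsterwalderSchraderCMP1973, §4.1 p. 93 (R5) and §4.2] -/
theorem OS1973_spectralCondition_holds : OS1973_spectralCondition :=
  fun _ _ _ hOS _ _ h𝒲 => fun n k => (h𝒲.spectralOSData hOS).spectral n |> fun h => by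
    obtain rfl := unitLabels_eq k; exact h

/-- **(R4) `OS1973_cluster` holds**: the boundary values of an OS continuation family have the
cluster property (Osterwalder–Schrader I (1973), §4.4, (4.29)–(4.30): E4 in vector notation on the
Wightman vectors of §4.3, `OS1973_cluster_of_vectors`, the vectors being supplied by
`SpectralOSData.exists_wightmanVectors` of `OSWightmanVectors`). [cite: OsterwalderSchraderCMP1973, §4.4 eqs. (4.29)–(4.30)] -/
theorem OS1973_cluster_holds : OS1973_cluster :=
  OS1973_cluster_of_vectors fun _ _ _ hOS _ _ h𝒲 => (h𝒲.spectralOSData hOS).exists_wightmanVectors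

/-- **(A₁₂⁺) from (A₁₂)**: the half-space support clause of
`OS1975_exists_continuation_halfSpace` is automatic for any forward-tube continuation
(`OS1975_exists_forwardTube_continuation`). [folklore] -/
theorem OS1975_exists_continuation_halfSpace_of_forwardTube (hA : OS1975_exists_forwardTube_continuation) :
    OS1975_exists_continuation_halfSpace := by
  intro d _ S hOS hE0'
  choose 𝔚 T h𝔚 hbv hS using hA d S hOS hE0'
  refine ⟨fun n _ => T n, fun n => ⟨𝔚 n, h𝔚 n, hbv n, hS n⟩, fun n k => ?_⟩
  have h𝒲 : IsOSContinuationFamily S (fun n _ => T n) := fun n => ⟨𝔚 n, h𝔚 n, hbv n, hS n⟩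
  exact h𝒲.fourierSupportedIn_halfSpectralSet hOS.covariant hOS.reflectionPositive n

/-- **`os_reconstruction` from (A₁₂) alone**: with the half-space support automatic, the OS
reconstruction theorem of the tree depends only on the existence of the forward-tube continuation
with distributional boundary values (`OS1975_exists_forwardTube_continuation`, OS II Thms. 4.1–4.3). [cite: OsterwalderSchraderCMP1975, §IV.1 Theorem E'→R']-/
theorem os_reconstruction_of_forwardTube (hA : OS1975_exists_forwardTube_continuation) : os_reconstruction :=
  os_reconstruction_of_exists_continuation_halfSpace (OS1975_exists_continuation_halfSpace_of_forwardTube hA)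

end Assembly



end Literature.MathematicalPhysics.QuantumFieldTheory
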